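import Mathlib
import Summits.Ventures.HodgeRepro2.T5WedgeRank
import Summits.Ventures.HodgeRepro2.T5PullbackRows

/-!
# A constant factor kills the wedge: `f_a` constant on `S_j` ⇒ `ω_{ab}|_{S_j} = 0`

Tier-5 support for sub-step N1 (Hodge-theoretic side, route/T5-N1-hodge-p6.md §H6,
«Consequences: if `f_a` or `f_b` is constant on `S_j` then `ω_{ab}|_{S_j} = 0`»).  In the chart
model of Remark A4.2.8 used by `T5PullbackRows` (row 35) — a map `F : (ι → 𝕜) → (κ → 𝕜)` on a
chart, the pulled-back coordinate covector `F^* dw_k = d(w_k ∘ F)` with coefficient vector the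
`k`-th row of the Jacobian — this is the one-line observation that a component `w_k ∘ F` which is
constant near `z` has zero differential there, so its Jacobian row vanishes and the `2 × 2` minor
of `T5WedgeRank.wedge10` (the coefficient of `ω_{ab}` at `z`, memo §H6 (ii) ⟺ (iii)) is `0`:

* `fderiv_coord_eq_zero_of_eventuallyEq_const`, `coeff_eq_zero_of_eventuallyEq_const`
  (Mathlib `Filter.EventuallyEq.fderiv_eq` + `fderiv_const`);
* `wedge10_rows_eq_zero_of_left_const` / `_right_const` (pointwise), their full-Jacobian forms
  `wedge10_fullRows_eq_zero_of_left_const` / `_right_const` (the row convention of rows 28 / 31 /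
  35) and `wedge10_rows_eq_zero_on_of_const_on` (on an open set on which the component is
  constant — on a component `S_j` on which `f_a` is constant, `ω_{ab}` vanishes identically).

The manifold, the universal covers and the lifts `f̃_a` stay prose: the chart map `F` is taken as
given, exactly as in rows 28 / 35.
-/

namespace Summit.Ventures.HodgeRepro2.T5ConstantFactor

open Filter Topology T5WedgeRank T5PullbackRows

variable {𝕜 : Type*} [NontriviallyNormedField 𝕜] {ι κ : Type*}

/-- A component `w_k ∘ F` that is eventually constant near `z` has zero differential at `z`. -/
theorem fderiv_coord_eq_zero_of_eventuallyEq_const {F : (ι → 𝕜) → κ → 𝕜} {z : ι → 𝕜} {k : κ}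
    {c : 𝕜} (h : (fun w => F w k) =ᶠ[𝓝 z] fun _ => c) :
    fderiv 𝕜 (fun w => F w k) z = 0 := by
  rw [h.fderiv_eq, fderiv_const_apply]

/-- The coefficient vector (Jacobian row) of `F^* dw_k` vanishes at `z` when `w_k ∘ F` is
eventually constant near `z`. -/
theorem coeff_eq_zero_of_eventuallyEq_const [DecidableEq ι] {F : (ι → 𝕜) → κ → 𝕜} {z : ι → 𝕜}
    {k : κ} {c : 𝕜} (h : (fun w => F w k) =ᶠ[𝓝 z] fun _ => c) :
    (fun i => (fderiv 𝕜 (fun w => F w k) z) (Pi.single i 1)) = 0 := by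
  ext i; rw [fderiv_coord_eq_zero_of_eventuallyEq_const h]; simp

/-- A component constant on an open set `U ∋ z` is eventually constant near `z`. -/
theorem eventuallyEq_const_of_const_on {F : (ι → 𝕜) → κ → 𝕜} {U : Set (ι → 𝕜)} (hU : IsOpen U)
    {z : ι → 𝕜} (hz : z ∈ U) {k : κ} {c : 𝕜} (hc : ∀ w ∈ U, F w k = c) :
    (fun w => F w k) =ᶠ[𝓝 z] fun _ => c :=
  Filter.eventually_of_mem (hU.mem_nhds hz) hc

/-! ### The two rows of the Jacobian and the coefficient of `ω_{ab}` -/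

/-- The Jacobian row of the component `a` of `F : ℂ² → ℂ²`, as a `(1,0)`-coefficient vector
(row 35's `coeff_fderiv_coord`; `𝕜 = ℂ` because `T5WedgeRank.wedge10` is the model over `ℂ`). -/
noncomputable abbrev jacRow (F : (Fin 2 → ℂ) → Fin 2 → ℂ) (z : Fin 2 → ℂ) (a : Fin 2) :
    Fin 2 → ℂ :=
  fun i => (fderiv ℂ (fun w => F w a) z) (Pi.single i 1)

/-- **`f_a` constant near `z` ⇒ `ω_{ab}` vanishes at `z`**: the coefficient `wedge10` of
`F^* dw_a ∧ F^* dw_b` (memo §H6 (ii) ⟺ (iii)) is `0` when the component `a` is eventually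
constant near `z`. -/
theorem wedge10_rows_eq_zero_of_left_const {F : (Fin 2 → ℂ) → Fin 2 → ℂ} {z : Fin 2 → ℂ}
    {a b : Fin 2} {c : ℂ} (h : (fun w => F w a) =ᶠ[𝓝 z] fun _ => c) :
    wedge10 (jacRow F z a) (jacRow F z b) = 0 := by
  have h0 : jacRow F z a = 0 := coeff_eq_zero_of_eventuallyEq_const h
  rw [h0]; simp [wedge10]

/-- **`f_b` constant near `z` ⇒ `ω_{ab}` vanishes at `z`**. -/
theorem wedge10_rows_eq_zero_of_right_const {F : (Fin 2 → ℂ) → Fin 2 → ℂ} {z : Fin 2 → ℂ}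
    {a b : Fin 2} {c : ℂ} (h : (fun w => F w b) =ᶠ[𝓝 z] fun _ => c) :
    wedge10 (jacRow F z a) (jacRow F z b) = 0 := by
  have h0 : jacRow F z b = 0 := coeff_eq_zero_of_eventuallyEq_const h
  rw [h0]; simp [wedge10]

/-- **On a set where `f_a` is constant, `ω_{ab}` vanishes identically** (memo §H6's consequence,
with `U` the chart image of a component `S_j` on which `f_a` is constant): for every `z ∈ U`,
the coefficient of `ω_{ab}` at `z` is `0`. -/
theorem wedge10_rows_eq_zero_on_of_const_on {F : (Fin 2 → ℂ) → Fin 2 → ℂ} {U : Set (Fin 2 → ℂ)}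
    (hU : IsOpen U) {a b : Fin 2} {c : ℂ} (hc : ∀ w ∈ U, F w a = c) :
    ∀ z ∈ U, wedge10 (jacRow F z a) (jacRow F z b) = 0 := fun _ hz =>
  wedge10_rows_eq_zero_of_left_const (eventuallyEq_const_of_const_on hU hz hc)

/-- The same with the roles of `a` and `b` exchanged. -/
theorem wedge10_rows_eq_zero_on_of_const_on' {F : (Fin 2 → ℂ) → Fin 2 → ℂ} {U : Set (Fin 2 → ℂ)}
    (hU : IsOpen U) {a b : Fin 2} {c : ℂ} (hc : ∀ w ∈ U, F w b = c) :
    ∀ z ∈ U, wedge10 (jacRow F z a) (jacRow F z b) = 0 := fun _ hz =>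
  wedge10_rows_eq_zero_of_right_const (eventuallyEq_const_of_const_on hU hz hc)

/-- The same for the rows of the FULL Jacobian `dF_z` (the convention of rows 28 / 31 / 35:
`fun i => dF_z (e_i)_a`), under differentiability of `F` at `z` (row 35's `coeff_fderiv_coord`
identifies the two descriptions of the row). -/
theorem wedge10_fullRows_eq_zero_of_left_const {F : (Fin 2 → ℂ) → Fin 2 → ℂ} {z : Fin 2 → ℂ}
    (hF : DifferentiableAt ℂ F z) {a b : Fin 2} {c : ℂ}
    (h : (fun w => F w a) =ᶠ[𝓝 z] fun _ => c) :
    wedge10 (fun i => (fderiv ℂ F z) (Pi.single i 1) a) (fun i => (fderiv ℂ F z) (Pi.single i 1) b)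
      = 0 := by
  rw [← coeff_fderiv_coord hF a, ← coeff_fderiv_coord hF b]
  exact wedge10_rows_eq_zero_of_left_const h

/-- The full-Jacobian form with the constant component `b`. -/
theorem wedge10_fullRows_eq_zero_of_right_const {F : (Fin 2 → ℂ) → Fin 2 → ℂ} {z : Fin 2 → ℂ}
    (hF : DifferentiableAt ℂ F z) {a b : Fin 2} {c : ℂ}
    (h : (fun w => F w b) =ᶠ[𝓝 z] fun _ => c) :
    wedge10 (fun i => (fderiv ℂ F z) (Pi.single i 1) a) (fun i => (fderiv ℂ F z) (Pi.single i 1) b)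
      = 0 := by
  rw [← coeff_fderiv_coord hF a, ← coeff_fderiv_coord hF b]
  exact wedge10_rows_eq_zero_of_right_const h

/-- Contrapositive, the form in which §H6 is used: a non-zero coefficient of `ω_{ab}` at some
`z ∈ U` forces both components to be non-constant on `U`. -/
theorem not_const_on_of_wedge10_rows_ne_zero {F : (Fin 2 → ℂ) → Fin 2 → ℂ} {U : Set (Fin 2 → ℂ)}
    (hU : IsOpen U) {a b : Fin 2} {z : Fin 2 → ℂ} (hz : z ∈ U)
    (h : wedge10 (jacRow F z a) (jacRow F z b) ≠ 0) :
    (¬ ∃ c, ∀ w ∈ U, F w a = c) ∧ (¬ ∃ c, ∀ w ∈ U, F w b = c) := by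
  constructor
  · rintro ⟨c, hc⟩; exact h (wedge10_rows_eq_zero_on_of_const_on hU hc z hz)
  · rintro ⟨c, hc⟩; exact h (wedge10_rows_eq_zero_on_of_const_on' hU hc z hz)

end Summit.Ventures.HodgeRepro2.T5ConstantFactor
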